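import Summits.CriticalPhenomena.PercolationContinuityZ3.Theorems.PercNearOneGluingNoHeavyLowerTailThreePointProductFormFibreHanging
import HarnessLib

/-!
# The product form in the fibre language: hanging parts are irrelevant for (S1J) and (S1J′) (reduction R0 for the system 𝒮)
# (Sahi programme, prover prim-sahi-p2 gen 56)

Support file (`--supports stmt-CriticalPhenomena-4575`, helper); companion of `…ThreePointProductFormFibreHanging` (gen 54: R0 for (P)).
Standard axioms, no sorries, no named facts, no definitions.  Memo `run/shared/lean/prim/prim-sahi/FROM-prim-sahi-p2-gen56-REFINED-PRODUCT-FORM.md` §10.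

SETTING of `…FibreHanging`: `D` hangs at the vertex `v` (labels inside `D ∪ {v}` / inside `Dᶜ ∪ {v}`), terminals in `(Dᶜ ∖ {v}) ∪ {v}`; `H°` makes the
`D`-labels loops at `v`.  The events `w = {a ↔ s, a ↮ c, s ↔ c in ♭z}`, `w′` and `J = {a ↔ s, a ↔ c}` are the same in `H` and `H°`
(`w_iff_hanging`, `joined_iff_hanging`), as `bad, P1, P2` are (gen 54); hence
* **`S1J_of_hanging`**, **`S1Jc_of_hanging`** [this work] — `(S1J)` `(#bad + w)² ≤ #P1·#J` and `(S1J′)` `(#bad + w′)² ≤ #P2·#J` transfer from `H°` to `H`.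
[folklore]; [cite: Gladkov2024, Conjecture 10.1 (p. 18), arXiv:2408.08457] for CONJECTURE (P) served.
-/

namespace Summit.CriticalPhenomena.PercolationContinuityZ3.Theorems.ProductFormFibre

open Finset Literature.Probability.Percolation
open Summit.CriticalPhenomena.PercolationContinuityZ3.Theorems.ThreePointCPIClusterSwap (clusterFlip)

variable {V α : Type*}

section HangingS1J

variable [DecidableEq V] (ends : α → Sym2 V) (v : V) (D : Set V) (inD : α → Prop) [DecidablePred inD]

/-- **`J = {a ↔ s, a ↔ c}` is the same event in `H` and in `H°`.** [this work] -/
theorem joined_iff_hanging (hD1 : ∀ l, inD l → ∀ u ∈ ends l, u ∈ D ∨ u = v)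
    (hD2 : ∀ l, ¬ inD l → ∀ u ∈ ends l, u ∉ D ∨ u = v) {a s c : V}
    (ha : (a ∉ D ∧ a ≠ v) ∨ a = v) (hs : (s ∉ D ∧ s ≠ v) ∨ s = v) (hc : (c ∉ D ∧ c ≠ v) ∨ c = v) (z : α → Bool) :
    ((openGraph (labelledOpen ends z)).Reachable a s ∧ (openGraph (labelledOpen ends z)).Reachable a c) ↔
    ((openGraph (labelledOpen (fun l => if inD l then s(v, v) else ends l) z)).Reachable a s ∧
      (openGraph (labelledOpen (fun l => if inD l then s(v, v) else ends l) z)).Reachable a c) := by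
  rw [openGraph_loops_eq ends v inD z,
    ← reachable_iff_restrict' ends v D inD hD1 hD2 z ha hs,
    ← reachable_iff_restrict' ends v D inD hD1 hD2 z ha hc]

/-- **`w`-type events are the same in `H` and in `H°`**: for any type condition `X` that is the same in `H` and `H°`, so is `X ∧ (s ↔ c in ♭z)`;
stated for `P1` (and, exchanging `s, c`, for `P2`). [this work] -/
theorem w_iff_hanging (hD1 : ∀ l, inD l → ∀ u ∈ ends l, u ∈ D ∨ u = v)
    (hD2 : ∀ l, ¬ inD l → ∀ u ∈ ends l, u ∉ D ∨ u = v) {a s c : V}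
    (ha : (a ∉ D ∧ a ≠ v) ∨ a = v) (hs : (s ∉ D ∧ s ≠ v) ∨ s = v) (hc : (c ∉ D ∧ c ≠ v) ∨ c = v) (z : α → Bool) :
    (((openGraph (labelledOpen ends z)).Reachable a s ∧ ¬ (openGraph (labelledOpen ends z)).Reachable a c) ∧
      (openGraph (labelledOpen ends (clusterFlip ends a fun x => !z x))).Reachable s c) ↔
    (((openGraph (labelledOpen (fun l => if inD l then s(v, v) else ends l) z)).Reachable a s ∧
        ¬ (openGraph (labelledOpen (fun l => if inD l then s(v, v) else ends l) z)).Reachable a c) ∧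
      (openGraph (labelledOpen (fun l => if inD l then s(v, v) else ends l)
        (clusterFlip (fun l => if inD l then s(v, v) else ends l) a fun x => !z x))).Reachable s c) := by
  classical
  rw [openGraph_loops_eq ends v inD z, openGraph_loops_eq ends v inD,
    ← reachable_iff_restrict' ends v D inD hD1 hD2 z ha hs,
    ← reachable_iff_restrict' ends v D inD hD1 hD2 z ha hc]
  have hfl : (fun l => if inD l then false else clusterFlip (fun l => if inD l then s(v, v) else ends l) a (fun x => !z x) l) =
      (fun l => if inD l then false else clusterFlip ends a (fun x => !z x) l) :=
    restrict_eq_of_agree inD fun l hin => (flat_eq_flat_loops_at ends v D inD hD1 hD2 a ha z hin).symm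
  rw [hfl, ← reachable_iff_restrict' ends v D inD hD1 hD2 _ hs hc]

end HangingS1J

section TransferS1JHanging

variable [Fintype α] [DecidableEq α] [DecidableEq V]

open Classical in
/-- **(S1J) transfers from `H°` to `H`**: a part hanging at any vertex is irrelevant for `(#bad + w)² ≤ #P1 · #J`. [this work] -/
theorem S1J_of_hanging (ends : α → Sym2 V) (v a s c : V) (D : Set V) (inD : α → Prop)
    (hD1 : ∀ l, inD l → ∀ u ∈ ends l, u ∈ D ∨ u = v) (hD2 : ∀ l, ¬ inD l → ∀ u ∈ ends l, u ∉ D ∨ u = v)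
    (ha : (a ∉ D ∧ a ≠ v) ∨ a = v) (hs : (s ∉ D ∧ s ≠ v) ∨ s = v) (hc : (c ∉ D ∧ c ≠ v) ∨ c = v)
    (hS : ((univ.filter fun z : α → Bool =>
        (¬ (openGraph (labelledOpen (fun l => if inD l then s(v, v) else ends l) z)).Reachable a s ∧
            ¬ (openGraph (labelledOpen (fun l => if inD l then s(v, v) else ends l) z)).Reachable a c ∧
            ¬ (openGraph (labelledOpen (fun l => if inD l then s(v, v) else ends l) z)).Reachable s c) ∧
          (openGraph (labelledOpen (fun l => if inD l then s(v, v) else ends l)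
            (clusterFlip (fun l => if inD l then s(v, v) else ends l) a fun x => !z x))).Reachable s c).card +
        (univ.filter fun z : α → Bool =>
          ((openGraph (labelledOpen (fun l => if inD l then s(v, v) else ends l) z)).Reachable a s ∧
              ¬ (openGraph (labelledOpen (fun l => if inD l then s(v, v) else ends l) z)).Reachable a c) ∧
            (openGraph (labelledOpen (fun l => if inD l then s(v, v) else ends l)
              (clusterFlip (fun l => if inD l then s(v, v) else ends l) a fun x => !z x))).Reachable s c).card) ^ 2 ≤
      (univ.filter fun z : α → Bool =>
        (openGraph (labelledOpen (fun l => if inD l then s(v, v) else ends l) z)).Reachable a s ∧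
          ¬ (openGraph (labelledOpen (fun l => if inD l then s(v, v) else ends l) z)).Reachable a c).card *
      (univ.filter fun z : α → Bool =>
        (openGraph (labelledOpen (fun l => if inD l then s(v, v) else ends l) z)).Reachable a s ∧
          (openGraph (labelledOpen (fun l => if inD l then s(v, v) else ends l) z)).Reachable a c).card) :
    ((univ.filter fun z : α → Bool =>
        (¬ (openGraph (labelledOpen ends z)).Reachable a s ∧ ¬ (openGraph (labelledOpen ends z)).Reachable a c ∧
            ¬ (openGraph (labelledOpen ends z)).Reachable s c) ∧
          (openGraph (labelledOpen ends (clusterFlip ends a fun x => !z x))).Reachable s c).card +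
      (univ.filter fun z : α → Bool =>
        ((openGraph (labelledOpen ends z)).Reachable a s ∧ ¬ (openGraph (labelledOpen ends z)).Reachable a c) ∧
          (openGraph (labelledOpen ends (clusterFlip ends a fun x => !z x))).Reachable s c).card) ^ 2 ≤
    (univ.filter fun z : α → Bool =>
        (openGraph (labelledOpen ends z)).Reachable a s ∧ ¬ (openGraph (labelledOpen ends z)).Reachable a c).card *
    (univ.filter fun z : α → Bool =>
        (openGraph (labelledOpen ends z)).Reachable a s ∧ (openGraph (labelledOpen ends z)).Reachable a c).card := by
  have e1 := Finset.filter_congr (s := (univ : Finset (α → Bool)))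
    fun z _ => bad_iff_hanging ends v D inD hD1 hD2 ha hs hc z
  have e2 := Finset.filter_congr (s := (univ : Finset (α → Bool)))
    fun z _ => w_iff_hanging ends v D inD hD1 hD2 ha hs hc z
  have e3 := Finset.filter_congr (s := (univ : Finset (α → Bool)))
    fun z _ => sa_iff_hanging ends v D inD hD1 hD2 ha hs hc z
  have e4 := Finset.filter_congr (s := (univ : Finset (α → Bool)))
    fun z _ => joined_iff_hanging ends v D inD hD1 hD2 ha hs hc z
  rw [e1, e2, e3, e4]
  exact hS

open Classical in
/-- **(S1J′) transfers from `H°` to `H`** (`(#bad + w′)² ≤ #P2 · #J`). [this work] -/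
theorem S1Jc_of_hanging (ends : α → Sym2 V) (v a s c : V) (D : Set V) (inD : α → Prop)
    (hD1 : ∀ l, inD l → ∀ u ∈ ends l, u ∈ D ∨ u = v) (hD2 : ∀ l, ¬ inD l → ∀ u ∈ ends l, u ∉ D ∨ u = v)
    (ha : (a ∉ D ∧ a ≠ v) ∨ a = v) (hs : (s ∉ D ∧ s ≠ v) ∨ s = v) (hc : (c ∉ D ∧ c ≠ v) ∨ c = v)
    (hS : ((univ.filter fun z : α → Bool =>
        (¬ (openGraph (labelledOpen (fun l => if inD l then s(v, v) else ends l) z)).Reachable a s ∧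
            ¬ (openGraph (labelledOpen (fun l => if inD l then s(v, v) else ends l) z)).Reachable a c ∧
            ¬ (openGraph (labelledOpen (fun l => if inD l then s(v, v) else ends l) z)).Reachable s c) ∧
          (openGraph (labelledOpen (fun l => if inD l then s(v, v) else ends l)
            (clusterFlip (fun l => if inD l then s(v, v) else ends l) a fun x => !z x))).Reachable s c).card +
        (univ.filter fun z : α → Bool =>
          ((openGraph (labelledOpen (fun l => if inD l then s(v, v) else ends l) z)).Reachable a c ∧
              ¬ (openGraph (labelledOpen (fun l => if inD l then s(v, v) else ends l) z)).Reachable a s) ∧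
            (openGraph (labelledOpen (fun l => if inD l then s(v, v) else ends l)
              (clusterFlip (fun l => if inD l then s(v, v) else ends l) a fun x => !z x))).Reachable s c).card) ^ 2 ≤
      (univ.filter fun z : α → Bool =>
        (openGraph (labelledOpen (fun l => if inD l then s(v, v) else ends l) z)).Reachable a c ∧
          ¬ (openGraph (labelledOpen (fun l => if inD l then s(v, v) else ends l) z)).Reachable a s).card *
      (univ.filter fun z : α → Bool =>
        (openGraph (labelledOpen (fun l => if inD l then s(v, v) else ends l) z)).Reachable a s ∧
          (openGraph (labelledOpen (fun l => if inD l then s(v, v) else ends l) z)).Reachable a c).card) :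
    ((univ.filter fun z : α → Bool =>
        (¬ (openGraph (labelledOpen ends z)).Reachable a s ∧ ¬ (openGraph (labelledOpen ends z)).Reachable a c ∧
            ¬ (openGraph (labelledOpen ends z)).Reachable s c) ∧
          (openGraph (labelledOpen ends (clusterFlip ends a fun x => !z x))).Reachable s c).card +
      (univ.filter fun z : α → Bool =>
        ((openGraph (labelledOpen ends z)).Reachable a c ∧ ¬ (openGraph (labelledOpen ends z)).Reachable a s) ∧
          (openGraph (labelledOpen ends (clusterFlip ends a fun x => !z x))).Reachable s c).card) ^ 2 ≤
    (univ.filter fun z : α → Bool =>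
        (openGraph (labelledOpen ends z)).Reachable a c ∧ ¬ (openGraph (labelledOpen ends z)).Reachable a s).card *
    (univ.filter fun z : α → Bool =>
        (openGraph (labelledOpen ends z)).Reachable a s ∧ (openGraph (labelledOpen ends z)).Reachable a c).card := by
  have e1 := Finset.filter_congr (s := (univ : Finset (α → Bool)))
    fun z _ => bad_iff_hanging ends v D inD hD1 hD2 ha hs hc z
  -- `w′`: the `P2`-type event with the flat connection; `sa_iff_hanging` with `s, c` exchanged handles the type, the flat part as in `w_iff_hanging`
  have e2 : (univ.filter fun z : α → Bool =>
        ((openGraph (labelledOpen ends z)).Reachable a c ∧ ¬ (openGraph (labelledOpen ends z)).Reachable a s) ∧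
          (openGraph (labelledOpen ends (clusterFlip ends a fun x => !z x))).Reachable s c) =
      (univ.filter fun z : α → Bool =>
          ((openGraph (labelledOpen (fun l => if inD l then s(v, v) else ends l) z)).Reachable a c ∧
              ¬ (openGraph (labelledOpen (fun l => if inD l then s(v, v) else ends l) z)).Reachable a s) ∧
            (openGraph (labelledOpen (fun l => if inD l then s(v, v) else ends l)
              (clusterFlip (fun l => if inD l then s(v, v) else ends l) a fun x => !z x))).Reachable s c) := by
    refine Finset.filter_congr fun z _ => ?_
    have h := w_iff_hanging ends v D inD hD1 hD2 ha hc hs z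
    have t := sa_iff_hanging ends v D inD hD1 hD2 ha hc hs z
    constructor
    · rintro ⟨h1, h2⟩
      exact ⟨t.1 h1, ((h.1 ⟨h1, h2.symm⟩).2).symm⟩
    · rintro ⟨h1, h2⟩
      exact ⟨t.2 h1, ((h.2 ⟨h1, h2.symm⟩).2).symm⟩
  have e3 := Finset.filter_congr (s := (univ : Finset (α → Bool)))
    fun z _ => sa_iff_hanging ends v D inD hD1 hD2 ha hc hs z
  have e4 := Finset.filter_congr (s := (univ : Finset (α → Bool)))
    fun z _ => joined_iff_hanging ends v D inD hD1 hD2 ha hs hc z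
  rw [e1, e2, e3, e4]
  exact hS

end TransferS1JHanging

end Summit.CriticalPhenomena.PercolationContinuityZ3.Theorems.ProductFormFibre
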